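import Mathlib
import HarnessLib
import Summits.QuantumFields.YangMills.Theses.PencilRigidity
import Literature.MathematicalPhysics.QuantumFieldTheory.OSReconstructionNoE1Proofs
import Summits.QuantumFields.YangMills.Theorems.PencilRigidityCurvatureKernelBoundKernelPinning
import Summits.QuantumFields.YangMills.Theorems.PencilRigidityCurvatureKernelBoundHalfSpaceKernelBumps
import Summits.QuantumFields.YangMills.Theorems.PencilRigidityCurvatureKernelBoundHalfSpaceKernelCluster
import Summits.QuantumFields.YangMills.Theorems.PencilRigidityCurvatureKernelBoundHalfSpaceKernelRiemann
import Summits.QuantumFields.YangMills.Theorems.PencilRigidityCurvatureKernelBoundHalfSpaceKernelLocalNorm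

/-!
# `CurvatureKernelBound` — stub H `HalfSpaceKernel`: the Riemann sums converge in the OS norm

(support for stmt-QuantumFields-11687, line `sixteen-charts-analytic-kernel`, skeleton v11)

`norm_riemannInner_sub_inner_le` (claim 1 of the identification). Headline (registered sub-goal): `ClosedBallPositiveTime`.
-/

noncomputable section

open scoped BigOperators Topology SchwartzMap ComplexConjugate InnerProductSpace
open MeasureTheory Filter Set Metric
open Literature.MathematicalPhysics.QuantumLattice Literature.MathematicalPhysics.AQFT
open Literature.MathematicalPhysics.QuantumFieldTheory
open Literature.MathematicalPhysics.QuantumLattice.SchwingerFamily (timeVec)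

namespace Summit.QuantumFields.YangMills.Theorems.CurvatureKernel

section Identification

variable (ϖ : (EuclideanSpace ℝ (Fin 4)) → ℝ) (hϖc : Continuous ϖ) (hϖ0 : ∀ x, 0 ≤ ϖ x) (hϖ1 : ∀ x, ϖ x ≤ 1)
  (hϖsupp : tsupport ϖ ⊆ Metric.closedBall (0 : (EuclideanSpace ℝ (Fin 4))) 2)
  (hϖle : ∀ (N : ℕ) (y : (EuclideanSpace ℝ (Fin 4))), ∑ j ∈ Fintype.piFinset (fun _ : Fin 4 => Finset.Icc (-(N : ℤ)) N),
    ϖ (y - WithLp.toLp 2 (fun i => ((j i : ℤ) : ℝ))) ≤ 1)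
  (hϖeq : ∀ (N : ℕ) (y : (EuclideanSpace ℝ (Fin 4))), (∀ i : Fin 4, |y i| ≤ N) →
    ∑ j ∈ Fintype.piFinset (fun _ : Fin 4 => Finset.Icc (-(N : ℤ)) N), ϖ (y - WithLp.toLp 2 (fun i => ((j i : ℤ) : ℝ))) = 1)
  (hI : 0 < ∫ x, ϖ x)
  (b : ℕ → (EuclideanSpace ℝ (Fin 4)) → 𝓢(EuclideanSpace ℝ (Fin 4), ℝ))
  (hb : ∀ (n : ℕ) (c x : EuclideanSpace ℝ (Fin 4)), b n c x = ϖ ((((n : ℝ) + 2)) • (x - c)))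
  {S : SchwingerFamily (EuclideanSpace ℝ (Fin 4))} (h : OSReconstructionNoE1 S.toLabelled)
  (htr : (∀ (n : ℕ) (a : (EuclideanSpace ℝ (Fin 4))) (F : SchwartzMap (Fin n → (EuclideanSpace ℝ (Fin 4))) ℂ), IsOffDiagonal F → S n (translateMulti a F) = S n F))
  (𝒰 : Ultrafilter ℕ) (h𝒰 : (↑𝒰 : Filter ℕ) ≤ atTop)

include hϖ0 hϖle hϖeq hI htr in
/-- **The field vectors of the Riemann sums converge** (stub H, claim 1 of the identification): with the bump
vectors `wₙ` at height `p` and a real `u` supported in `B̄(q,R)` well above height `p`, the finite sums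
`Σ_j u(Δₙj) Δₙ⁴∫ϖ ⟪Φ, e^{-((Δₙj)⁰−p)H}U(Δₙj⃗) wₙ⟫` — which ARE `⟪Φ, Ψ_{Rₙ}⟫` for the Riemann sums `Rₙ = Σ_j u(Δₙj) b n (Δₙj)`
— are eventually `ε`-close to `⟪Φ, Ψ_u⟫` (uniform convergence `Rₙ → u` by the exact partition of unity, and the
local `L^∞`-type bound `norm_fieldVec_ofRealTest_sq_le`). [folklore] -/
theorem norm_riemannInner_sub_inner_le
    (p r₀ A B : ℝ) (hA : 0 ≤ A) (hB : 0 ≤ B)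
    (hLB : (∀ (r : ℝ), 0 < r → r ≤ r₀ → ∀ (f : Fin 2 → SchwartzMap (EuclideanSpace ℝ (Fin 4)) ℝ) (F : SchwartzMap (Fin 2 → (EuclideanSpace ℝ (Fin 4))) ℂ) (M₀ M₁ : ℝ), IsTensorOf F (fun i => ofRealTest (f i)) → tsupport ((f 0 : SchwartzMap (EuclideanSpace ℝ (Fin 4)) ℝ) : (EuclideanSpace ℝ (Fin 4)) → ℝ) ⊆ Metric.closedBall (EuclideanSpace.single (0 : Fin 4) (-p)) r → tsupport ((f 1 : SchwartzMap (EuclideanSpace ℝ (Fin 4)) ℝ) : (EuclideanSpace ℝ (Fin 4)) → ℝ) ⊆ Metric.closedBall (EuclideanSpace.single (0 : Fin 4) p) r → (∀ x, |f 0 x| ≤ M₀) → (∀ x, |f 1 x| ≤ M₁) → ‖S 2 F‖ ≤ A * (∫ x : (EuclideanSpace ℝ (Fin 4)), |f 0 x|) * (∫ x : (EuclideanSpace ℝ (Fin 4)), |f 1 x|) + B * r ^ 8 * M₀ * M₁))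
    (w : ℕ → h.Hilbert)
    (hw : ∀ (n : ℕ) (hn : 2 * ((n : ℝ) + 2)⁻¹ < (EuclideanSpace.single (0 : Fin 4) p : EuclideanSpace ℝ (Fin 4)) 0),
      w n = ((((((n : ℝ) + 2)⁻¹) ^ 4 * ∫ x, ϖ x)⁻¹ : ℝ) : ℂ) •
        h.fieldVec 1 (fun _ => ()) _ (isTimeOrdered_tensorFin_one (tsupport_ofRealTest_bump_pos ϖ hϖsupp b hb n hn)))
    (u : 𝓢(EuclideanSpace ℝ (Fin 4), ℝ)) (q : EuclideanSpace ℝ (Fin 4)) (R : ℝ) (hR : 0 < R)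
    (hu : tsupport (u : EuclideanSpace ℝ (Fin 4) → ℝ) ⊆ Metric.closedBall q R)
    (hRr : 4 * R ≤ r₀) (hRp : 4 * R ≤ p) (hq : p + 2 * R ≤ q 0)
    (hupos : tsupport ((ofRealTest u : 𝓢(EuclideanSpace ℝ (Fin 4), ℂ)) : EuclideanSpace ℝ (Fin 4) → ℂ) ⊆ {y | 0 < y 0})
    (Φ : h.Hilbert) (N : ℕ → ℕ) (hNΔ : ∀ n : ℕ, ‖q‖ + R + 1 ≤ (N n : ℝ) * ((n : ℝ) + 2)⁻¹) :
    ∀ ε > (0 : ℝ), ∀ᶠ n : ℕ in atTop,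
      ‖(∑ j ∈ Fintype.piFinset (fun _ : Fin 4 => Finset.Icc (-(N n : ℤ)) (N n)),
        (u (((n : ℝ) + 2)⁻¹ • WithLp.toLp 2 (fun i => ((j i : ℤ) : ℝ))) : ℂ) *
          ((((n : ℝ) + 2)⁻¹ ^ 4 * ∫ x, ϖ x : ℝ) : ℂ) *
          ⟪Φ, h.transfer ((((n : ℝ) + 2)⁻¹ • WithLp.toLp 2 (fun i => ((j i : ℤ) : ℝ)) : EuclideanSpace ℝ (Fin 4)) 0 - p)
            (h.translate (((n : ℝ) + 2)⁻¹ • WithLp.toLp 2 (fun i => ((j i : ℤ) : ℝ))) (w n))⟫_ℂ) -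
        ⟪Φ, h.fieldVec 1 (fun _ => ()) _ (isTimeOrdered_tensorFin_one hupos)⟫_ℂ‖ ≤ ε := by
  intro ε hε
  -- ### notation
  set I : ℝ := ∫ x, ϖ x with hIdef
  set cP : EuclideanSpace ℝ (Fin 4) := EuclideanSpace.single 0 p with hcP
  have hcP0 : cP 0 = p := by simp [hcP]
  have hΔpos : ∀ n : ℕ, (0 : ℝ) < ((n : ℝ) + 2)⁻¹ := fun n => by positivity
  have hΔ : Tendsto (fun n : ℕ => ((n : ℝ) + 2)⁻¹) atTop (𝓝 0) :=
    tendsto_inv_atTop_zero.comp (tendsto_natCast_atTop_atTop.atTop_add tendsto_const_nhds)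
  set gpt : ℕ → (Fin 4 → ℤ) → EuclideanSpace ℝ (Fin 4) := fun n j => ((n : ℝ) + 2)⁻¹ • WithLp.toLp 2 (fun i => ((j i : ℤ) : ℝ)) with hgpt
  set J : ℕ → Finset (Fin 4 → ℤ) := fun n => Fintype.piFinset (fun _ : Fin 4 => Finset.Icc (-(N n : ℤ)) (N n)) with hJ
  show ∀ᶠ n : ℕ in atTop, ‖(∑ j ∈ J n, (u (gpt n j) : ℂ) * ((((n : ℝ) + 2)⁻¹ ^ 4 * I : ℝ) : ℂ) *
      ⟪Φ, h.transfer (gpt n j 0 - p) (h.translate (gpt n j) (w n))⟫_ℂ) -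
      ⟪Φ, h.fieldVec 1 (fun _ => ()) _ (isTimeOrdered_tensorFin_one hupos)⟫_ℂ‖ ≤ ε
  -- geometry of the contributing grid points
  have hgpt_mem : ∀ n j, u (gpt n j) ≠ 0 → gpt n j ∈ Metric.closedBall q R := fun n j hj =>
    hu (subset_tsupport _ (Function.mem_support.2 hj))
  have hgpt0 : ∀ n j, u (gpt n j) ≠ 0 → q 0 - R ≤ gpt n j 0 := by
    intro n j hj
    have h1 := hgpt_mem n j hj
    rw [Metric.mem_closedBall, dist_eq_norm] at h1
    have h2 : |(gpt n j - q) 0| ≤ ‖gpt n j - q‖ := by simpa using PiLp.norm_apply_le (p := 2) (gpt n j - q) 0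
    rw [PiLp.sub_apply, abs_le] at h2
    linarith [h2.1]
  have hregion : ∀ n : ℕ, 4 * ((n : ℝ) + 2)⁻¹ ≤ 1 → ∀ x ∈ Metric.closedBall q (R + 2 * ((n : ℝ) + 2)⁻¹),
      ∀ i : Fin 4, |x i| + 2 * ((n : ℝ) + 2)⁻¹ ≤ N n * ((n : ℝ) + 2)⁻¹ := by
    intro n hn x hx i
    rw [Metric.mem_closedBall, dist_eq_norm] at hx
    have h1 : |x i| ≤ ‖x‖ := by simpa using PiLp.norm_apply_le (p := 2) x i
    have h2 : ‖x‖ ≤ ‖q‖ + (R + 2 * ((n : ℝ) + 2)⁻¹) := by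
      have := norm_le_norm_add_norm_sub' x q
      rw [norm_sub_rev] at hx
      linarith [norm_sub_rev q x]
    linarith [hNΔ n]
  -- ### constants and the tolerance for the uniform approximation
  set Cq : ℝ := A * (volume (Metric.closedBall q (2 * R))).toReal ^ 2 + B * (2 * R) ^ 8 with hCq
  have hCq0 : 0 ≤ Cq := by positivity
  set ε₁ : ℝ := ε / (‖Φ‖ * Real.sqrt Cq + 1) with hε₁
  have hε₁pos : 0 < ε₁ := by positivity
  have hε₁le : ‖Φ‖ * Real.sqrt Cq * ε₁ ≤ ε := by
    rw [hε₁, mul_div_assoc']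
    rw [div_le_iff₀ (by positivity)]
    nlinarith [mul_nonneg (norm_nonneg Φ) (Real.sqrt_nonneg Cq)]
  -- uniform continuity of `u`
  have hu_cpt : HasCompactSupport (u : EuclideanSpace ℝ (Fin 4) → ℝ) :=
    HasCompactSupport.of_support_subset_isCompact (isCompact_closedBall q R) ((subset_tsupport _).trans hu)
  obtain ⟨δ, hδ, hδu⟩ := Metric.uniformContinuous_iff.1 (hu_cpt.uniformContinuous_of_continuous u.continuous) ε₁ hε₁pos
  -- ### eventually: small scales
  have hev : ∀ᶠ n : ℕ in atTop, 4 * ((n : ℝ) + 2)⁻¹ ≤ 1 ∧ 2 * ((n : ℝ) + 2)⁻¹ < δ ∧ 2 * ((n : ℝ) + 2)⁻¹ < R := by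
    refine ((hΔ.const_mul 4).eventually (ge_mem_nhds ?_)).and
      (((hΔ.const_mul 2).eventually (gt_mem_nhds ?_)).and ((hΔ.const_mul 2).eventually (gt_mem_nhds ?_)))
    · norm_num
    · simpa using hδ
    · simpa using hR
  filter_upwards [hev] with n hn
  obtain ⟨hn1, hn2, hn3⟩ := hn
  set Δ : ℝ := ((n : ℝ) + 2)⁻¹ with hΔdef
  have hΔp : 0 < Δ := hΔpos n
  have hΔn : ((n : ℝ) + 2) * Δ = 1 := by rw [hΔdef]; field_simp
  -- positivity data for the bumps at the contributing grid points and at `cP`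
  have hnP : 2 * Δ < cP 0 := by rw [hcP0]; linarith
  have hngpt : ∀ j, u (gpt n j) ≠ 0 → 2 * Δ < gpt n j 0 := fun j hj => by linarith [hgpt0 n j hj]
  have hPle : ∀ j, u (gpt n j) ≠ 0 → cP 0 ≤ gpt n j 0 := fun j hj => by rw [hcP0]; linarith [hgpt0 n j hj]
  -- ### the Riemann sum as a real Schwartz function
  classical
  set J' : Finset (Fin 4 → ℤ) := (J n).filter (fun j => u (gpt n j) ≠ 0) with hJ'
  have hJ'mem : ∀ j ∈ J', u (gpt n j) ≠ 0 := fun j hj => (Finset.mem_filter.1 hj).2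
  set RS : 𝓢(EuclideanSpace ℝ (Fin 4), ℝ) := ∑ j ∈ J', u (gpt n j) • b n (gpt n j) with hRS
  have hbgrid : ∀ j x, b n (gpt n j) x = ϖ (Δ⁻¹ • x - WithLp.toLp 2 (fun i => ((j i : ℤ) : ℝ))) := by
    intro j x
    rw [hb, smul_sub]
    congr 2
    · rw [hΔdef, inv_inv]
    · show ((n : ℝ) + 2) • (((n : ℝ) + 2)⁻¹ • WithLp.toLp 2 (fun i => ((j i : ℤ) : ℝ))) = _
      rw [smul_smul, mul_inv_cancel₀ (by positivity), one_smul]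
  have hRS_apply : ∀ x, RS x = ∑ j ∈ J n, u (gpt n j) * ϖ (Δ⁻¹ • x - WithLp.toLp 2 (fun i => ((j i : ℤ) : ℝ))) := by
    intro x
    rw [hRS, sum_apply, hJ', Finset.sum_filter_of_ne]
    · exact Finset.sum_congr rfl fun j _ => by rw [smul_apply, smul_eq_mul, hbgrid]
    · intro j _ hj h0
      rw [smul_apply, h0, zero_smul] at hj
      exact hj rfl
  -- uniform closeness `|RS − u| ≤ ε₁`
  have hclose : ∀ x, |RS x - u x| ≤ ε₁ := by
    intro x
    have hmod : ∀ x y : EuclideanSpace ℝ (Fin 4), dist x y ≤ 2 * Δ → ‖(u x : ℂ) - u y‖ ≤ ε₁ := fun x y hxy => by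
      rw [← Complex.ofReal_sub, Complex.norm_real, ← dist_eq_norm]; exact (hδu (lt_of_le_of_lt hxy hn2)).le
    have hsupp' : ∀ x : EuclideanSpace ℝ (Fin 4), (u x : ℂ) ≠ 0 → ∀ i : Fin 4, |x i| + 2 * Δ ≤ N n * Δ := by
      intro x hx
      have hx' : u x ≠ 0 := fun h0 => hx (by simp [h0])
      refine hregion n hn1 x ?_
      exact Metric.closedBall_subset_closedBall (by linarith) (hu (subset_tsupport _ (Function.mem_support.2 hx')))
    have h1 := norm_riemannSum_sub_le ϖ hϖ0 hϖsupp hϖle hϖeq hΔp (N n) (fun x => (u x : ℂ)) hsupp' hε₁pos.le hmod x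
    have e : (∑ j ∈ J n, (u (Δ • WithLp.toLp 2 (fun i => ((j i : ℤ) : ℝ))) : ℂ) *
        (ϖ (Δ⁻¹ • x - WithLp.toLp 2 (fun i => ((j i : ℤ) : ℝ))) : ℂ)) - (u x : ℂ) = ((RS x - u x : ℝ) : ℂ) := by
      rw [hRS_apply]; push_cast; rfl
    rw [e, Complex.norm_real, Real.norm_eq_abs] at h1
    exact h1
  -- supports
  have hRS_tsupp : tsupport (RS : EuclideanSpace ℝ (Fin 4) → ℝ) ⊆ Metric.closedBall q (R + 2 * Δ) := by
    refine closure_minimal (fun x hx => ?_) Metric.isClosed_closedBall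
    rw [Function.mem_support] at hx
    by_contra hxq
    refine hx ?_
    rw [hRS, sum_apply]
    refine Finset.sum_eq_zero fun j hj => ?_
    rw [smul_apply]
    have hjm := hgpt_mem n j (hJ'mem j hj)
    have hbx : b n (gpt n j) x = 0 := by
      refine image_eq_zero_of_notMem_tsupport fun hx' => hxq ?_
      have := tsupport_bump_subset ϖ hϖsupp b hb n (gpt n j) hx'
      rw [Metric.mem_closedBall] at this hjm ⊢
      linarith [dist_triangle x (gpt n j) q]
    rw [hbx, smul_zero]
  have hR2 : Metric.closedBall q (R + 2 * Δ) ⊆ Metric.closedBall q (2 * R) := Metric.closedBall_subset_closedBall (by linarith)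
  have hpos2R : Metric.closedBall q (2 * R) ⊆ {y : EuclideanSpace ℝ (Fin 4) | 0 < y 0} := by
    intro y hy
    rw [Metric.mem_closedBall, dist_eq_norm] at hy
    have h1 : |(y - q) 0| ≤ ‖y - q‖ := by simpa using PiLp.norm_apply_le (p := 2) (y - q) 0
    rw [PiLp.sub_apply, abs_le] at h1
    show 0 < y 0
    linarith [h1.1]
  set f : 𝓢(EuclideanSpace ℝ (Fin 4), ℝ) := RS - u with hf
  have hf_tsupp : tsupport (f : EuclideanSpace ℝ (Fin 4) → ℝ) ⊆ Metric.closedBall q (2 * R) := by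
    rw [hf]
    exact (tsupport_sub (RS : EuclideanSpace ℝ (Fin 4) → ℝ) (u : EuclideanSpace ℝ (Fin 4) → ℝ)).trans (Set.union_subset (hRS_tsupp.trans hR2) (hu.trans (Metric.closedBall_subset_closedBall (by linarith))))
  have hfpos : tsupport ((ofRealTest f : 𝓢(EuclideanSpace ℝ (Fin 4), ℂ)) : EuclideanSpace ℝ (Fin 4) → ℂ) ⊆ {y | 0 < y 0} :=
    ((tsupport_comp_subset (g := fun r : ℝ => (r : ℂ)) Complex.ofReal_zero _).trans hf_tsupp).trans hpos2R
  have hRSpos : tsupport ((ofRealTest RS : 𝓢(EuclideanSpace ℝ (Fin 4), ℂ)) : EuclideanSpace ℝ (Fin 4) → ℂ) ⊆ {y | 0 < y 0} :=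
    ((tsupport_comp_subset (g := fun r : ℝ => (r : ℂ)) Complex.ofReal_zero _).trans (hRS_tsupp.trans hR2)).trans hpos2R
  -- ### the norm estimate `‖Ψ_f‖ ≤ √Cq ε₁`
  have hMf : ∀ x, |f x| ≤ ε₁ := fun x => by rw [hf, sub_apply]; exact hclose x
  have hnormf : ‖h.fieldVec 1 (fun _ => ()) _ (isTimeOrdered_tensorFin_one hfpos)‖ ≤ Real.sqrt Cq * ε₁ := by
    have h1 := norm_fieldVec_ofRealTest_sq_le h htr p r₀ A B hA hLB q (2 * R) (by linarith) (by linarith) (by linarith)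
      (by linarith) f hf_tsupp ε₁ hMf hfpos
    rw [← hCq] at h1
    rw [← Real.sqrt_sq (norm_nonneg _), ← Real.sqrt_sq hε₁pos.le, ← Real.sqrt_mul hCq0]
    exact Real.sqrt_le_sqrt h1
  -- ### `Ψ_{RS} − Ψ_u = Ψ_f`
  have hsub : h.fieldVec 1 (fun _ => ()) _ (isTimeOrdered_tensorFin_one hRSpos) -
      h.fieldVec 1 (fun _ => ()) _ (isTimeOrdered_tensorFin_one hupos) =
      h.fieldVec 1 (fun _ => ()) _ (isTimeOrdered_tensorFin_one hfpos) := by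
    have e : ofRealTest RS - ofRealTest u = ofRealTest f := by rw [hf, map_sub]
    have hpos' : tsupport ((ofRealTest RS - ofRealTest u : 𝓢(EuclideanSpace ℝ (Fin 4), ℂ)) : EuclideanSpace ℝ (Fin 4) → ℂ) ⊆ {y | 0 < y 0} := by
      rw [e]; exact hfpos
    rw [← fieldVec_one_sub h hRSpos hupos hpos']
    exact fieldVec_one_congr h (by rw [e]) _ _
  -- ### the sum IS `⟪Φ, Ψ_{RS}⟫`
  have hsumeq : (∑ j ∈ J n, (u (gpt n j) : ℂ) * ((Δ ^ 4 * I : ℝ) : ℂ) *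
      ⟪Φ, h.transfer (gpt n j 0 - p) (h.translate (gpt n j) (w n))⟫_ℂ) =
      ⟪Φ, h.fieldVec 1 (fun _ => ()) _ (isTimeOrdered_tensorFin_one hRSpos)⟫_ℂ := by
    -- the field vector of the Riemann sum is the combination of the bump vectors at the grid points
    have hbpos : ∀ j : {j // j ∈ J'}, tsupport ((ofRealTest (b n (gpt n j.1)) : 𝓢(EuclideanSpace ℝ (Fin 4), ℂ)) :
        EuclideanSpace ℝ (Fin 4) → ℂ) ⊆ {y | 0 < y 0} := fun j =>
      tsupport_ofRealTest_bump_pos ϖ hϖsupp b hb n (hngpt j.1 (hJ'mem j.1 j.2))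
    have hsumS : (∑ j : {j // j ∈ J'}, (u (gpt n j.1) : ℂ) • (ofRealTest (b n (gpt n j.1)) : 𝓢(EuclideanSpace ℝ (Fin 4), ℂ))) =
        ofRealTest RS := by
      rw [hRS, map_sum, ← Finset.sum_coe_sort J']
      refine Finset.sum_congr rfl fun j _ => ?_
      ext x
      simp [ofRealTest_apply, smul_apply]
    have hsumpos : tsupport ((∑ j : {j // j ∈ J'}, (u (gpt n j.1) : ℂ) • (ofRealTest (b n (gpt n j.1)) : 𝓢(EuclideanSpace ℝ (Fin 4), ℂ)) :
        𝓢(EuclideanSpace ℝ (Fin 4), ℂ)) : EuclideanSpace ℝ (Fin 4) → ℂ) ⊆ {y | 0 < y 0} := by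
      rw [hsumS]; exact hRSpos
    have hV := fieldVec_one_finset_sum h (Finset.univ : Finset {j // j ∈ J'}) (fun j => (u (gpt n j.1) : ℂ))
      (fun j => ofRealTest (b n (gpt n j.1))) hbpos hsumpos
    rw [fieldVec_one_congr h (congrArg (fun φ => SchwartzMap.tensorFin 1 ![φ]) hsumS) _ (isTimeOrdered_tensorFin_one hRSpos)] at hV
    rw [hV, inner_sum]
    -- restrict the total sum to the contributing grid points and pass to the subtype
    rw [← Finset.sum_filter_of_ne (s := J n) (p := fun j => u (gpt n j) ≠ 0) (fun j _ hj h0 => hj (by simp [h0])),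
      ← hJ', ← Finset.sum_coe_sort J']
    refine Finset.sum_congr rfl fun j _ => ?_
    rw [inner_smul_right]
    -- the bump vector at the grid point is the translate of the one at `cP`, which is `(Δ⁴ I) • w n`
    have hjne : u (gpt n j.1) ≠ 0 := hJ'mem j.1 j.2
    have hT := transfer_translate_bumpVec ϖ hϖsupp b hb h n hnP (hngpt j.1 hjne) (hPle j.1 hjne)
    have hwn := hw n hnP
    have hm : ((Δ ^ 4 * I : ℝ) : ℂ) ≠ 0 := by
      rw [Ne, Complex.ofReal_eq_zero]; positivity
    have hVc : h.fieldVec 1 (fun _ => ()) _ (isTimeOrdered_tensorFin_one (tsupport_ofRealTest_bump_pos ϖ hϖsupp b hb n hnP)) =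
        ((Δ ^ 4 * I : ℝ) : ℂ) • w n := by
      rw [hwn, smul_smul, ← Complex.ofReal_mul, mul_inv_cancel₀ (by positivity), Complex.ofReal_one, one_smul]
    rw [← hT, hVc, LinearIsometryEquiv.map_smul, ContinuousLinearMap.map_smul, inner_smul_right]
    have htime : (gpt n j.1 - cP) 0 = gpt n j.1 0 - p := by rw [PiLp.sub_apply, hcP0]
    have hspace : h.translate (gpt n j.1 - cP) (w n) = h.translate (gpt n j.1) (w n) := by
      have hsp : spatialPart 0 (gpt n j.1 - cP) = spatialPart 0 (gpt n j.1) := by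
        ext i; by_cases hi : i = 0 <;> simp [hcP, hi]
      rw [← h.translate_spatialPart, hsp, h.translate_spatialPart]
    rw [htime, hspace]
    ring
  -- ### assembly
  rw [hsumeq, ← inner_sub_right, hsub]
  calc ‖⟪Φ, h.fieldVec 1 (fun _ => ()) _ (isTimeOrdered_tensorFin_one hfpos)⟫_ℂ‖
      ≤ ‖Φ‖ * ‖h.fieldVec 1 (fun _ => ()) _ (isTimeOrdered_tensorFin_one hfpos)‖ := norm_inner_le_norm _ _
    _ ≤ ‖Φ‖ * (Real.sqrt Cq * ε₁) := mul_le_mul_of_nonneg_left hnormf (norm_nonneg _)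
    _ ≤ ε := by rw [← mul_assoc]; exact hε₁le

end Identification

/-- **Sub-goal `ClosedBallPositiveTime`** (helper-file headline for stub `HalfSpaceKernel`; registered signature): a
closed ball of radius `ρ` about `q` lies in positive time as soon as `ρ < q⁰`. [folklore] -/
theorem ClosedBallPositiveTime : ∀ (q : EuclideanSpace ℝ (Fin 4)) (ρ : ℝ), ρ < q 0 → Metric.closedBall q ρ ⊆ {y : EuclideanSpace ℝ (Fin 4) | 0 < y 0} := by
  intro q ρ hρ y hy
  rw [Metric.mem_closedBall, dist_eq_norm] at hy
  have h1 : |(y - q) 0| ≤ ‖y - q‖ := by simpa using PiLp.norm_apply_le (p := 2) (y - q) 0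
  rw [PiLp.sub_apply, abs_le] at h1
  show 0 < y 0
  linarith [h1.1]

end Summit.QuantumFields.YangMills.Theorems.CurvatureKernel

end
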